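import Literature.NumberTheory.EllipticCurves.Gamma0EisensteinHeckeIdentity
import HarnessLib

/-!
# The Eisenstein series of the cusp `∞` of `Γ₀(N)`, IV: Möbius inversion —
# `J_s(N) G_N(z, s) = Σ_{t ∣ N} μ(N/t) tˢ G₁(tz, s)` and `J_s(N) = N^{2s} ∏_{p ∣ N} (1 − p^{−2s}) > 0`

Topic `Literature/NumberTheory/EllipticCurves`; two definitions (names for the objects the tree
writes out in full: `levelEisensteinG u z s = G_u(z, s) = Σ_{(c,d)=1, u ∣ c} (y/|cz+d|²)ˢ = 2E_∞^{Γ₀(u)}(z, s)`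
and the Möbius weight `moebiusWeight s u = J_s(u) = Σ_{de = u} μ(d) e^{2s}`), one auxiliary
arithmetic function (`rpowArith`), and theorems. Sequel to `Gamma0EisensteinHeckeIdentity` (the
Hecke-type identity `Σ_{u ∣ t} J_s(u) G_u(z, s) = tˢ G₁(tz, s)`, real `s > 1`,
`sum_divisors_moebius_mul_tsum_coprime_eq`). Here that identity, valid for every `t ≥ 1`, is
inverted on the divisor lattice (Mathlib `ArithmeticFunction.sum_eq_iff_sum_mul_moebius_eq`):

* `moebiusWeight_mul_levelEisensteinG_eq_sum` — **`J_s(N) G_N(z, s) = Σ_{t ∣ N} μ(N/t) tˢ G₁(tz, s)`**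
  (`s > 1`, `N ≥ 1`): the Eisenstein series of the cusp `∞` of `Γ₀(N)` is an explicit finite
  combination of the LEVEL-ONE series at the points `tz`, `t ∣ N` (Diamond–Shurman §4.2 / Iwaniec
  §3.2, classical; e.g. `E_∞^{Γ₀(p)}(z, s) = (p^{2s} − 1)⁻¹ (pˢ E(pz, s) − E(z, s))`);
* `moebiusWeight_prime_pow`, `moebiusWeight_eq_prod_factorization`, **`moebiusWeight_pos`** —
  `J_s(p^k) = p^{2ks} − p^{2(k−1)s}`, `J_s(N) = ∏_{p^k ∥ N} (p^{2ks} − p^{2(k−1)s})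
  = N^{2s}∏_{p∣N}(1 − p^{−2s})`, positive for `s > 0` (multiplicativity of `μ * n^{2s}`);
* `levelEisensteinG_eq_inv_mul_sum` — the inverted form `G_N = J_s(N)⁻¹ Σ_{t∣N} μ(N/t) tˢ G₁(tz, s)`;
* `ofReal_levelEisensteinG_one` — `G₁(z, s) = 2E(z, s)` (`eisensteinE`, the tree's level-one series).

Purpose (towards the named fact `murty_petersson_newform_lower_bound`, Murty 1999 §2): paired with the
Petersson density `|f|²y²` of `f ∈ S₂(Γ₀(N))` over a fundamental domain, the left side is the
Rankin–Selberg integral of `f` at the cusp `∞` (the tree's unfolding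
`Gamma0RankinSelbergUnfolding.lintegral_domain_mul_eisenstein_eq`), while each term on the right is
an integral against the level-one `E(tz, s)`, whose meromorphic continuation is in the tree
(`Literature.NumberTheory.Automorphic.ModularEisensteinContinuation`,
`RankinSelbergContinuationSL2`): this is the route to the continuation of `Σ |aₙ|² n^{-s}` for level
`N` and hence of `ζ(2s)Σ|aₙ|²n^{-s-1} = ζ(s)L(s, Sym² f)` (to come).

## References

* [DiamondShurman2005] F. Diamond, J. Shurman, *A First Course in Modular Forms*, GTM 228, §4.2
  (Eisenstein series of level `N` from level one) and §4.10.
* [Iwaniec2002] H. Iwaniec, *Spectral Methods of Automorphic Forms*, GSM 53, §3.2 (3.10)–(3.11),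
  §2.3–2.4 (cusps and Eisenstein series of `Γ₀(N)`).

## Mathlib / tree search

Tree: `sum_divisors_moebius_mul_tsum_coprime_eq`, `ofReal_tsum_coprime_eq_two_mul_eisensteinE`
(`Gamma0EisensteinHeckeIdentity`); `tendsto_sub_one_mul_tsum_coprime_dvd` (`Gamma0EisensteinResidue`,
the residue by induction over the divisors — the pointwise identity here was not recorded). Mathlib:
`ArithmeticFunction.sum_eq_iff_sum_mul_moebius_eq`, `Nat.sum_divisorsAntidiagonal'`,
`ArithmeticFunction.IsMultiplicative.multiplicative_factorization`, `ArithmeticFunction.moebius_apply_prime_pow`,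
`Nat.divisors_prime_pow`.
-/

noncomputable section

open scoped MatrixGroups Real
open UpperHalfPlane hiding I
open ArithmeticFunction
open scoped ArithmeticFunction.Moebius
open Literature.NumberTheory.Automorphic

namespace Literature.NumberTheory.EllipticCurves.ModularForms

/-! ### The objects -/

/-- **`G_u(z, s) = Σ_{(c,d)=1, u ∣ c} (Im z/|cz + d|²)ˢ`** (`= 2 E_∞^{Γ₀(u)}(z, s)` for real `s > 1`;
`G₁ = 2E(z, s)`): the series the tree writes out in `Gamma0RankinSelbergUnfolding`,
`Gamma0EisensteinHeckeIdentity`, `Gamma0EisensteinResidue`, now named.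
[cite: Iwaniec2002, §3.2 (3.10)–(3.11), PDF pp. 42–43] -/
def levelEisensteinG (u : ℕ) (z : ℍ) (s : ℝ) : ℝ :=
  ∑' v : {v : Fin 2 → ℤ // IsCoprime (v 0) (v 1) ∧ (u : ℤ) ∣ v 0},
    (z.im / Complex.normSq ((v.1 0 : ℂ) * z + v.1 1)) ^ s

/-- **The Möbius weight `J_s(u) = Σ_{de = u} μ(d) e^{2s}`** (so that `Σ_{u ∣ n} J_s(u) = n^{2s}`).
[cite: DiamondShurman2005, §4.2] -/
def moebiusWeight (s : ℝ) (u : ℕ) : ℝ :=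
  ∑ x ∈ u.divisorsAntidiagonal, (μ x.1 : ℝ) * (x.2 : ℝ) ^ (2 * s)

/-- `G₁(z, s) = 2 E(z, s)` (the tree's `ofReal_tsum_coprime_eq_two_mul_eisensteinE`). [folklore] -/
theorem ofReal_levelEisensteinG_one (z : ℍ) (s : ℝ) :
    (levelEisensteinG 1 z s : ℂ) = 2 * eisensteinE z s := by
  unfold levelEisensteinG
  exact_mod_cast ofReal_tsum_coprime_eq_two_mul_eisensteinE z s

/-- `G_u(z, s) ≥ 0`. [folklore] -/
theorem levelEisensteinG_nonneg (u : ℕ) (z : ℍ) (s : ℝ) : 0 ≤ levelEisensteinG u z s :=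
  tsum_nonneg fun _ => Real.rpow_nonneg (div_nonneg z.im_pos.le (Complex.normSq_nonneg _)) _

/-! ### The Hecke-type identity and its Möbius inversion -/

/-- The tree's Hecke-type identity in the present names: `Σ_{u ∣ t} J_s(u) G_u(z, s) = tˢ G₁(tz, s)`
(`s > 1`, `t ≥ 1`). [cite: DiamondShurman2005, §4.2] -/
theorem sum_divisors_moebiusWeight_mul_levelEisensteinG (z : ℍ) {s : ℝ} (hs : 1 < s) {t : ℕ}
    (ht : 0 < t) :
    ∑ u ∈ t.divisors, moebiusWeight s u * levelEisensteinG u z s =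
      (t : ℝ) ^ s * levelEisensteinG 1 ((⟨t, by exact_mod_cast ht⟩ : {x : ℝ // 0 < x}) • z) s := by
  unfold moebiusWeight levelEisensteinG
  exact_mod_cast sum_divisors_moebius_mul_tsum_coprime_eq z hs ht

/-- **Möbius inversion: `J_s(N) G_N(z, s) = Σ_{t ∣ N} μ(N/t) tˢ G₁(tz, s)`** for `s > 1`, `N ≥ 1`
(the sum runs over the divisors `t` of `N`, attached to their membership proofs for the scaling
`tz`). The Eisenstein series of the cusp `∞` of `Γ₀(N)` through the level-one series at the points
`tz`. [cite: DiamondShurman2005, §4.2] -/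
theorem moebiusWeight_mul_levelEisensteinG_eq_sum (z : ℍ) {s : ℝ} (hs : 1 < s) {N : ℕ} (hN : 0 < N) :
    moebiusWeight s N * levelEisensteinG N z s =
      ∑ t ∈ N.divisors.attach, (μ (N / t.1) : ℝ) * ((t.1 : ℝ) ^ s *
        levelEisensteinG 1 ((⟨t.1, by exact_mod_cast Nat.pos_of_mem_divisors t.2⟩ : {x : ℝ // 0 < x}) • z) s) := by
  classical
  set g : ℕ → ℝ := fun t => if h : 0 < t then
      (t : ℝ) ^ s * levelEisensteinG 1 ((⟨t, by exact_mod_cast h⟩ : {x : ℝ // 0 < x}) • z) s else 0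
    with hg
  have hrel : ∀ n > 0, ∑ u ∈ n.divisors, moebiusWeight s u * levelEisensteinG u z s = g n := by
    intro n hn
    rw [hg]
    dsimp only
    rw [dif_pos hn]
    exact sum_divisors_moebiusWeight_mul_levelEisensteinG z hs hn
  have hinv := (sum_eq_iff_sum_mul_moebius_eq
    (f := fun u => moebiusWeight s u * levelEisensteinG u z s) (g := g)).mp hrel N hN
  rw [← hinv, Nat.sum_divisorsAntidiagonal' (fun d t => (μ d : ℝ) * g t), ← Finset.sum_attach]
  refine Finset.sum_congr rfl fun t _ => ?_
  rw [hg]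
  dsimp only
  rw [dif_pos (Nat.pos_of_mem_divisors t.2)]

/-! ### `J_s(N) = ∏_{p^k ∥ N} (p^{2ks} − p^{2(k−1)s}) > 0` -/

/-- `n ↦ nᵃ` as an arithmetic function (value `0` at `0`). [folklore] -/
def rpowArith (a : ℝ) : ArithmeticFunction ℝ :=
  ⟨fun n => if n = 0 then 0 else (n : ℝ) ^ a, if_pos rfl⟩

/-- `rpowArith a n = nᵃ` for `n ≠ 0`. [folklore] -/
theorem rpowArith_apply {a : ℝ} {n : ℕ} (hn : n ≠ 0) : rpowArith a n = (n : ℝ) ^ a := by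
  simp [rpowArith, hn]

/-- `n ↦ nᵃ` is multiplicative. [folklore] -/
theorem isMultiplicative_rpowArith (a : ℝ) : (rpowArith a).IsMultiplicative := by
  refine ⟨by simp [rpowArith], fun {m n} _ => ?_⟩
  rcases Nat.eq_zero_or_pos m with rfl | hm
  · simp [rpowArith]
  rcases Nat.eq_zero_or_pos n with rfl | hn
  · simp [rpowArith]
  rw [rpowArith_apply (Nat.mul_ne_zero hm.ne' hn.ne'), rpowArith_apply hm.ne', rpowArith_apply hn.ne',
    Nat.cast_mul, Real.mul_rpow (Nat.cast_nonneg m) (Nat.cast_nonneg n)]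

/-- `J_s = μ * n^{2s}` (Dirichlet convolution). [folklore] -/
theorem moebiusWeight_eq_mul_apply (s : ℝ) (u : ℕ) :
    moebiusWeight s u = ((μ : ArithmeticFunction ℝ) * rpowArith (2 * s)) u := by
  rw [mul_apply]
  unfold moebiusWeight
  refine Finset.sum_congr rfl fun x hx => ?_
  have hx' := Nat.mem_divisorsAntidiagonal.mp hx
  have hx2 : x.2 ≠ 0 := by
    intro h
    apply hx'.2
    rw [← hx'.1, h, mul_zero]
  rw [intCoe_apply, rpowArith_apply hx2]

/-- `J_s` is multiplicative. [folklore] -/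
theorem isMultiplicative_moebius_mul_rpowArith (s : ℝ) :
    ((μ : ArithmeticFunction ℝ) * rpowArith (2 * s)).IsMultiplicative :=
  isMultiplicative_moebius.intCast.mul (isMultiplicative_rpowArith _)

/-- **`J_s(p^k) = p^{2ks} − p^{2(k−1)s}`** for a prime `p` and `k ≥ 1` (only `μ(1)` and `μ(p)`
contribute). [cite: DiamondShurman2005, §4.2] -/
theorem moebiusWeight_prime_pow (s : ℝ) {p : ℕ} (hp : p.Prime) {k : ℕ} (hk : 0 < k) :
    moebiusWeight s (p ^ k) = ((p : ℝ) ^ (2 * s)) ^ k - ((p : ℝ) ^ (2 * s)) ^ (k - 1) := by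
  classical
  unfold moebiusWeight
  rw [Nat.sum_divisorsAntidiagonal (fun d e => (μ d : ℝ) * (e : ℝ) ^ (2 * s)),
    Nat.divisors_prime_pow hp k, Finset.sum_map]
  obtain ⟨k, rfl⟩ : ∃ k', k = k' + 1 := ⟨k - 1, by omega⟩
  simp only [Function.Embedding.coeFn_mk, Nat.add_sub_cancel]
  rw [Finset.sum_range_succ', Finset.sum_range_succ']
  have hp0 : 0 < p := hp.pos
  have hpr : (0 : ℝ) ≤ p := Nat.cast_nonneg p
  -- the terms with `i ≥ 2` vanish
  have hvan : ∑ i ∈ Finset.range k,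
      (μ (p ^ (i + 1 + 1)) : ℝ) * ((p ^ (k + 1) / p ^ (i + 1 + 1) : ℕ) : ℝ) ^ (2 * s) = 0 := by
    refine Finset.sum_eq_zero fun i _ => ?_
    rw [moebius_apply_prime_pow hp (by omega : i + 1 + 1 ≠ 0), if_neg (by omega)]
    simp
  rw [hvan, zero_add, pow_zero, Nat.div_one, zero_add, pow_one, moebius_apply_prime hp,
    ArithmeticFunction.moebius_apply_one, pow_succ, Nat.mul_div_cancel _ hp0]
  have hcomm : ∀ m : ℕ, (((p ^ m : ℕ) : ℝ)) ^ (2 * s) = ((p : ℝ) ^ (2 * s)) ^ m := by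
    intro m
    rw [Nat.cast_pow, ← Real.rpow_natCast (p : ℝ) m, ← Real.rpow_natCast ((p : ℝ) ^ (2 * s)) m,
      ← Real.rpow_mul hpr, ← Real.rpow_mul hpr, mul_comm]
  rw [← pow_succ, hcomm, hcomm]
  push_cast
  ring

/-- **`J_s(N) = ∏_{p^k ∥ N} (p^{2ks} − p^{2(k−1)s})`** (`= N^{2s} ∏_{p ∣ N}(1 − p^{-2s})`) for `N ≠ 0`.
[cite: DiamondShurman2005, §4.2] -/
theorem moebiusWeight_eq_prod_factorization (s : ℝ) {N : ℕ} (hN : N ≠ 0) :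
    moebiusWeight s N =
      N.factorization.prod fun p k => ((p : ℝ) ^ (2 * s)) ^ k - ((p : ℝ) ^ (2 * s)) ^ (k - 1) := by
  rw [moebiusWeight_eq_mul_apply,
    (isMultiplicative_moebius_mul_rpowArith s).multiplicative_factorization _ hN]
  unfold Finsupp.prod
  refine Finset.prod_congr rfl fun p hp => ?_
  have hp' : p.Prime := Nat.prime_of_mem_primeFactors (Nat.support_factorization N ▸ hp)
  have hk : 0 < N.factorization p := Nat.pos_of_ne_zero (Finsupp.mem_support_iff.mp hp)
  dsimp only
  rw [← moebiusWeight_eq_mul_apply, moebiusWeight_prime_pow s hp' hk]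

/-- **`J_s(N) > 0`** for `s > 0`, `N ≥ 1` (each factor `p^{2(k−1)s}(p^{2s} − 1)` is positive).
[cite: DiamondShurman2005, §4.2] -/
theorem moebiusWeight_pos {s : ℝ} (hs : 0 < s) {N : ℕ} (hN : 0 < N) : 0 < moebiusWeight s N := by
  rw [moebiusWeight_eq_prod_factorization s hN.ne']
  unfold Finsupp.prod
  refine Finset.prod_pos fun p hp => ?_
  have hp' : p.Prime := Nat.prime_of_mem_primeFactors (Nat.support_factorization N ▸ hp)
  have hk : 0 < N.factorization p := Nat.pos_of_ne_zero (Finsupp.mem_support_iff.mp hp)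
  have hgt : 1 < (p : ℝ) ^ (2 * s) :=
    Real.one_lt_rpow (by exact_mod_cast hp'.one_lt) (by linarith)
  obtain ⟨k, hk'⟩ : ∃ k, N.factorization p = k + 1 := ⟨N.factorization p - 1, by omega⟩
  dsimp only
  rw [hk', Nat.add_sub_cancel, pow_succ]
  have hpos : 0 < ((p : ℝ) ^ (2 * s)) ^ k := pow_pos (by linarith) k
  nlinarith

/-- **The inverted form**: `G_N(z, s) = J_s(N)⁻¹ Σ_{t ∣ N} μ(N/t) tˢ G₁(tz, s)` (`s > 1`, `N ≥ 1`).
[cite: DiamondShurman2005, §4.2] -/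
theorem levelEisensteinG_eq_inv_mul_sum (z : ℍ) {s : ℝ} (hs : 1 < s) {N : ℕ} (hN : 0 < N) :
    levelEisensteinG N z s = (moebiusWeight s N)⁻¹ *
      ∑ t ∈ N.divisors.attach, (μ (N / t.1) : ℝ) * ((t.1 : ℝ) ^ s *
        levelEisensteinG 1 ((⟨t.1, by exact_mod_cast Nat.pos_of_mem_divisors t.2⟩ : {x : ℝ // 0 < x}) • z) s) := by
  rw [← moebiusWeight_mul_levelEisensteinG_eq_sum z hs hN, ← mul_assoc,
    inv_mul_cancel₀ (moebiusWeight_pos (by linarith) hN).ne', one_mul]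

end Literature.NumberTheory.EllipticCurves.ModularForms

end
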